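import Summits.CriticalPhenomena.Ising3DConformalLimit.Theses.PerfectScreening
import Literature.Probability.LatticeModels.HighDimPointwiseTriviality
import Literature.Probability.LatticeModels.GeneralisedFreeFamily

/-!
# `CoulombImpliesNontrivial` (item stmt-CriticalPhenomena-13885): the LATTICE shadow is false

Negative/structural knowledge about the crux `…Theses.PerfectScreening.CoulombImpliesNontrivial`
(route PerfectScreening, r3), from its standing crux disprover (D-0016).

`not_latticeShadow`: the statement obtained from r3 by replacing the critical Ising correlators
`criticalCorr 3` with an ARBITRARY lattice family `G` whose two-point function obeys the two-sided Coulomb law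
`c/‖x‖ ≤ G₂(0,x) ≤ C/‖x‖` is FALSE: the massless free family `gffFamily (1/2)` SAMPLED ON `ℤ³`
(`sampleOnLattice`) is such a `G`, and it has the genuine (full filter, all orders, locally uniform) pointwise
scaling limit `gffFamily (1/2)` under `ρ(δ) = δ^{-1/2}` — non-degenerate, with `U₄ ≡ 0`. So not even "being
the pointwise scaling limit of a lattice family with a Coulomb two-point function" forces interaction: a proof
of r3 must use properties of `criticalCorr 3` beyond its two-point function (random currents, `σ² = 1`).

Reusable tool (any `d`): `hasPointwiseScalingLimit_sampleOnLattice` — a scale-covariant continuum family that is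
continuous on non-coincident configurations, sampled on `ℤ^d`, has itself as pointwise scaling limit
(`tendstoLocallyUniformlyOn_comp_of_approx`: composing a function continuous on an open set of a proper space
with uniformly small perturbations of the identity converges locally uniformly).
-/

noncomputable section

namespace Summit.CriticalPhenomena.Ising3DConformalLimit.CoulombImpliesNontrivialNegative

open Literature.Probability.LatticeModels Filter Set Metric
open Summit.CriticalPhenomena.Ising3DConformalLimit.Theses
open scoped Topology

variable {d : ℕ}

/-! ### A topological lemma -/

/-- Composing a function `F`, continuous on an open set `U` of a proper metric space, with maps `φᵢ` that
are uniformly close to the identity (`dist (φᵢ z) z < ε` for all `z`, eventually in `i`) gives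
`F ∘ φᵢ → F` locally uniformly on `U`. [folklore] -/
theorem tendstoLocallyUniformlyOn_comp_of_approx {X : Type*} [PseudoMetricSpace X] [ProperSpace X]
    {ι : Type*} {p : Filter ι} {F : X → ℝ} {U : Set X} (hU : IsOpen U) (hF : ContinuousOn F U)
    (φ : ι → X → X) (hφ : ∀ ε > 0, ∀ᶠ i in p, ∀ z, dist (φ i z) z < ε) :
    TendstoLocallyUniformlyOn (fun i z => F (φ i z)) F p U := by
  rw [Metric.tendstoLocallyUniformlyOn_iff]
  intro ε hε x hx
  obtain ⟨r, hr, hball⟩ := Metric.isOpen_iff.1 hU x hx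
  have hK : IsCompact (closedBall x (r / 2)) := isCompact_closedBall x (r / 2)
  have hKU : closedBall x (r / 2) ⊆ U := (closedBall_subset_ball (by linarith)).trans hball
  have huc : UniformContinuousOn F (closedBall x (r / 2)) :=
    hK.uniformContinuousOn_of_continuous (hF.mono hKU)
  rw [Metric.uniformContinuousOn_iff] at huc
  obtain ⟨η, hη, hmod⟩ := huc ε hε
  refine ⟨U ∩ ball x (r / 4), inter_mem_nhdsWithin U (ball_mem_nhds x (by linarith)), ?_⟩
  filter_upwards [hφ (min η (r / 4)) (lt_min hη (by linarith))] with i hi y hy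
  have hyx : dist y x < r / 4 := hy.2
  have hy1 : y ∈ closedBall x (r / 2) := by
    rw [mem_closedBall]
    linarith
  have hy2 : φ i y ∈ closedBall x (r / 2) := by
    rw [mem_closedBall]
    have h1 : dist (φ i y) y < r / 4 := (hi y).trans_le (min_le_right _ _)
    linarith [dist_triangle (φ i y) y x]
  have h3 : dist y (φ i y) < η := by
    rw [dist_comm]; exact (hi y).trans_le (min_le_left _ _)
  exact hmod y hy1 (φ i y) hy2 h3

/-! ### Lattice sampling of continuum families -/

/-- The continuum family `S` sampled on the lattice: `(n, y) ↦ S n (y₁, …, yₙ)` with `yᵢ ∈ ℤ^d ⊆ ℝ^d`. [folklore] -/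
def sampleOnLattice (S : CorrFamily d) : LatticeCorrFamily d := fun n y => S n (fun i => siteVec (y i))

/-- The rescaled lattice approximation of a configuration: `z ↦ (δ[z₁/δ], …, δ[zₙ/δ])`. [folklore] -/
def approxConfig (n : ℕ) (δ : ℝ) (z : Fin n → EuclideanSpace ℝ (Fin d)) : Fin n → EuclideanSpace ℝ (Fin d) :=
  fun i => δ • siteVec (latticeApprox δ (z i))

/-- `‖δ[q/δ] - q‖₂ ≤ d·δ` for `δ > 0` (each coordinate is off by at most `δ`). [folklore] -/
theorem norm_smul_siteVec_latticeApprox_sub_le {δ : ℝ} (hδ : 0 < δ) (q : EuclideanSpace ℝ (Fin d)) :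
    ‖δ • siteVec (latticeApprox δ q) - q‖ ≤ d * δ := by
  rw [EuclideanSpace.norm_eq]
  have hcoord : ∀ k, ‖(δ • siteVec (latticeApprox δ q) - q) k‖ ^ 2 ≤ δ ^ 2 := by
    intro k
    have h := abs_mul_latticeApprox_sub_le hδ q k
    have h' : ‖(δ • siteVec (latticeApprox δ q) - q) k‖ = |δ * (latticeApprox δ q k : ℝ) - q k| := by
      rw [Real.norm_eq_abs, PiLp.sub_apply, PiLp.smul_apply, siteVec_apply, smul_eq_mul]
    rw [h']
    have h0 : 0 ≤ |δ * (latticeApprox δ q k : ℝ) - q k| := abs_nonneg _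
    nlinarith
  have hsum : ∑ k, ‖(δ • siteVec (latticeApprox δ q) - q) k‖ ^ 2 ≤ (d * δ) ^ 2 := by
    calc ∑ k, ‖(δ • siteVec (latticeApprox δ q) - q) k‖ ^ 2 ≤ ∑ _k : Fin d, δ ^ 2 :=
          Finset.sum_le_sum fun k _ => hcoord k
      _ = d * δ ^ 2 := by simp
      _ ≤ (d * δ) ^ 2 := by
          rw [mul_pow]
          have hd1 : (d : ℝ) ≤ (d : ℝ) ^ 2 := by
            rcases Nat.eq_zero_or_pos d with h | h
            · simp [h]
            · have : (1:ℝ) ≤ d := by exact_mod_cast h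
              nlinarith
          exact mul_le_mul_of_nonneg_right hd1 (by positivity)
  calc Real.sqrt (∑ k, ‖(δ • siteVec (latticeApprox δ q) - q) k‖ ^ 2) ≤ Real.sqrt ((d * δ) ^ 2) :=
        Real.sqrt_le_sqrt hsum
    _ = d * δ := Real.sqrt_sq (by positivity)

/-- The rescaled lattice approximations are uniformly close to the identity: `dist (approxConfig n δ z) z ≤ d·δ`. [folklore] -/
theorem dist_approxConfig_le {n : ℕ} {δ : ℝ} (hδ : 0 < δ) (z : Fin n → EuclideanSpace ℝ (Fin d)) :
    dist (approxConfig n δ z) z ≤ d * δ := by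
  refine (dist_pi_le_iff (by positivity)).2 fun i => ?_
  rw [dist_eq_norm]
  exact norm_smul_siteVec_latticeApprox_sub_le hδ (z i)

/-- Eventually (as `δ → 0⁺`) the rescaled lattice approximations are `ε`-close to the identity, uniformly. [folklore] -/
theorem eventually_dist_approxConfig_lt (n : ℕ) {ε : ℝ} (hε : 0 < ε) :
    ∀ᶠ δ in 𝓝[>] (0:ℝ), ∀ z : Fin n → EuclideanSpace ℝ (Fin d), dist (approxConfig n δ z) z < ε := by
  have hm : Set.Ioo (0:ℝ) (ε / (d + 1)) ∈ 𝓝[>] (0:ℝ) := Ioo_mem_nhdsGT (by positivity)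
  filter_upwards [hm] with δ hδ z
  refine (dist_approxConfig_le hδ.1 z).trans_lt ?_
  have h := hδ.2
  rw [lt_div_iff₀ (by positivity)] at h
  have hd0 : (0:ℝ) ≤ d := by positivity
  nlinarith [hδ.1]

/-- For `δ > 0` the rescaled correlator of the sampled family under `ρ(δ) = δ^{-Δ}` is the continuum family
evaluated at the rescaled lattice approximation (scale covariance). [folklore] -/
theorem rescaledCorrelator_sampleOnLattice {S : CorrFamily d} {Δ : ℝ} (hsc : IsScaleCovariant Δ S)
    (n : ℕ) {δ : ℝ} (hδ : 0 < δ) (z : Fin n → EuclideanSpace ℝ (Fin d)) :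
    rescaledCorrelator (sampleOnLattice S) (fun δ => δ ^ (-Δ)) n δ z = S n (approxConfig n δ z) := by
  rw [rescaledCorrelator_apply]
  have h := hsc n δ hδ (fun i => siteVec (latticeApprox δ (z i)))
  change S n (approxConfig n δ z) = δ ^ (-(n : ℝ) * Δ) * S n (fun i => siteVec (latticeApprox δ (z i))) at h
  rw [h]
  congr 1
  rw [show (-(n : ℝ) * Δ) = (-Δ) * n by ring, Real.rpow_mul hδ.le, Real.rpow_natCast]

/-- **A scale-covariant continuum family, continuous on non-coincident configurations, sampled on `ℤ^d`, has
ITSELF as pointwise scaling limit** under `ρ(δ) = δ^{-Δ}` (full filter `δ → 0⁺`, every order, locally uniformly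
on `NonCoincident`). [folklore] -/
theorem hasPointwiseScalingLimit_sampleOnLattice {S : CorrFamily d} {Δ : ℝ} (hsc : IsScaleCovariant Δ S)
    (hcont : ∀ n, ContinuousOn (S n) (NonCoincident d n)) :
    HasPointwiseScalingLimit (sampleOnLattice S) (fun δ => δ ^ (-Δ)) S := by
  intro n
  have hgen := tendstoLocallyUniformlyOn_comp_of_approx (isOpen_nonCoincident d n) (hcont n)
    (fun δ z => approxConfig n δ z) (fun ε hε => eventually_dist_approxConfig_lt n hε)
  rw [Metric.tendstoLocallyUniformlyOn_iff] at hgen ⊢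
  intro ε hε x hx
  obtain ⟨t, ht, hev⟩ := hgen ε hε x hx
  refine ⟨t, ht, ?_⟩
  filter_upwards [hev, self_mem_nhdsWithin] with δ hδ hδpos y hy
  rw [rescaledCorrelator_sampleOnLattice hsc n hδpos]
  exact hδ y hy

/-! ### The generalised free family: continuity, and its lattice sampling -/

/-- `gffTwo Δ` is continuous off the diagonal, as a function of a pair picked from a configuration. [folklore] -/
theorem continuousOn_gffTwo_pair (Δ : ℝ) {n : ℕ} {i j : Fin n} (hij : i ≠ j) :
    ContinuousOn (fun z : Fin n → EuclideanSpace ℝ (Fin 3) => gffTwo Δ (z i) (z j)) (NonCoincident 3 n) := by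
  unfold gffTwo
  refine ContinuousOn.rpow_const (((continuous_apply i).sub (continuous_apply j)).norm.continuousOn) ?_
  intro z hz
  left
  have hinj : Function.Injective z := hz
  exact norm_ne_zero_iff.2 (sub_ne_zero.2 fun h => hij (hinj h))

/-- The generalised free family is continuous on non-coincident configurations, at every order. [folklore] -/
theorem continuousOn_gffFamily (Δ : ℝ) : ∀ n, ContinuousOn (gffFamily Δ n) (NonCoincident 3 n)
  | 0 => continuousOn_const
  | 1 => continuousOn_const
  | 2 => continuousOn_gffTwo_pair Δ (by decide : (0 : Fin 2) ≠ 1)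
  | 3 => continuousOn_const
  | 4 => ((continuousOn_gffTwo_pair Δ (by decide : (0 : Fin 4) ≠ 1)).mul
        (continuousOn_gffTwo_pair Δ (by decide : (2 : Fin 4) ≠ 3))).add
      ((continuousOn_gffTwo_pair Δ (by decide : (0 : Fin 4) ≠ 2)).mul
        (continuousOn_gffTwo_pair Δ (by decide : (1 : Fin 4) ≠ 3))) |>.add
      ((continuousOn_gffTwo_pair Δ (by decide : (0 : Fin 4) ≠ 3)).mul
        (continuousOn_gffTwo_pair Δ (by decide : (1 : Fin 4) ≠ 2)))
  | _ + 5 => continuousOn_const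

/-- **The generalised free family sampled on `ℤ³` has itself as pointwise scaling limit** (`ρ(δ) = δ^{-Δ}`). [folklore] -/
theorem hasPointwiseScalingLimit_gff_sample (Δ : ℝ) :
    HasPointwiseScalingLimit (sampleOnLattice (gffFamily Δ)) (fun δ => δ ^ (-Δ)) (gffFamily Δ) :=
  hasPointwiseScalingLimit_sampleOnLattice (isScaleCovariant_gff Δ) (continuousOn_gffFamily Δ)

/-- `‖siteVec x‖₂ ≤ 2‖x‖_∞` on `ℤ³` (`√3 ≤ 2`). [folklore] -/
theorem norm_siteVec_le (x : Site 3) : ‖siteVec x‖ ≤ 2 * ‖x‖ := by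
  rw [EuclideanSpace.norm_eq]
  have hc : ∀ k, ‖siteVec x k‖ ^ 2 ≤ ‖x‖ ^ 2 := by
    intro k
    rw [siteVec_apply]
    have h : ‖(x k : ℝ)‖ ≤ ‖x‖ := by
      have := norm_le_pi_norm x k
      rwa [Int.norm_cast_real]
    have h0 : 0 ≤ ‖(x k : ℝ)‖ := norm_nonneg _
    nlinarith
  have hs : ∑ k, ‖siteVec x k‖ ^ 2 ≤ (2 * ‖x‖) ^ 2 := by
    calc ∑ k, ‖siteVec x k‖ ^ 2 ≤ ∑ _k : Fin 3, ‖x‖ ^ 2 := Finset.sum_le_sum fun k _ => hc k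
      _ = 3 * ‖x‖ ^ 2 := by simp
      _ ≤ (2 * ‖x‖) ^ 2 := by nlinarith [norm_nonneg x]
  calc Real.sqrt (∑ k, ‖siteVec x k‖ ^ 2) ≤ Real.sqrt ((2 * ‖x‖) ^ 2) := Real.sqrt_le_sqrt hs
    _ = 2 * ‖x‖ := Real.sqrt_sq (by positivity)

/-- `‖x‖_∞ ≤ ‖siteVec x‖₂` on `ℤ³`. [folklore] -/
theorem norm_le_norm_siteVec (x : Site 3) : ‖x‖ ≤ ‖siteVec x‖ := by
  refine (pi_norm_le_iff_of_nonneg (norm_nonneg _)).2 fun k => ?_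
  have h := PiLp.norm_apply_le (siteVec x) k
  rw [siteVec_apply, Int.norm_cast_real] at h
  exact h

/-- The sampled massless free family has the exact Coulomb two-point function `1/‖siteVec x‖₂`. [folklore] -/
theorem sampleOnLattice_gff_half_two (x : Site 3) :
    sampleOnLattice (gffFamily (1/2)) 2 ![0, x] = 1 / ‖siteVec x‖ := by
  show gffTwo (1/2) (siteVec ((![0, x] : Fin 2 → Site 3) 0)) (siteVec ((![0, x] : Fin 2 → Site 3) 1)) = _
  simp only [Matrix.cons_val_zero, Matrix.cons_val_one]
  rw [gffTwo, show (-(2 * (1/2 : ℝ))) = -1 by norm_num, Real.rpow_neg_one, one_div]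
  congr 1
  have h0 : siteVec (0 : Site 3) = 0 := by
    ext k; simp [siteVec_apply]
  rw [h0, zero_sub, norm_neg]

/-- **The LATTICE shadow of r3 is FALSE**: replacing `criticalCorr 3` by an arbitrary lattice family with a
two-sided Coulomb two-point function, the statement fails for the massless free family sampled on `ℤ³`
(scaling limit `gffFamily (1/2)` under `ρ = δ^{-1/2}`: non-degenerate, `U₄ ≡ 0`). [cite: FrancescoMathieuSenechal1997, §4.3.1] -/
theorem not_latticeShadow :
    ¬ ∀ G : LatticeCorrFamily 3,
      (∃ c : ℝ, 0 < c ∧ ∀ x : Site 3, x ≠ 0 → c / ‖x‖ ≤ G 2 ![0, x]) →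
      (∃ C : ℝ, ∀ x : Site 3, x ≠ 0 → G 2 ![0, x] ≤ C / ‖x‖) →
      ∀ (ρ : ℝ → ℝ) (S : CorrFamily 3), (∀ δ ∈ Set.Ioc (0:ℝ) 1, 0 < ρ δ) →
        HasPointwiseScalingLimit G ρ S → IsNondegenerateTwoPoint S → HasNontrivialU4 S := by
  intro h
  refine not_hasNontrivialU4_gff (1/2) (h (sampleOnLattice (gffFamily (1/2))) ?_ ?_ (fun δ => δ ^ (-(1/2:ℝ)))
    (gffFamily (1/2)) (fun δ hδ => Real.rpow_pos_of_pos hδ.1 _) (hasPointwiseScalingLimit_gff_sample (1/2))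
    (isNondegenerateTwoPoint_gff _))
  · refine ⟨1/2, by norm_num, fun x hx => ?_⟩
    rw [sampleOnLattice_gff_half_two]
    have hx1 : (0:ℝ) < ‖x‖ := norm_pos_iff.2 hx
    have h2 := norm_siteVec_le x
    have hpos : 0 < ‖siteVec x‖ := hx1.trans_le (norm_le_norm_siteVec x)
    rw [div_le_div_iff₀ hx1 hpos]
    linarith
  · refine ⟨1, fun x hx => ?_⟩
    rw [sampleOnLattice_gff_half_two]
    have hx1 : (0:ℝ) < ‖x‖ := norm_pos_iff.2 hx
    exact one_div_le_one_div_of_le hx1 (norm_le_norm_siteVec x)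

end Summit.CriticalPhenomena.Ising3DConformalLimit.CoulombImpliesNontrivialNegative

end
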